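import Mathlib
import HarnessLib

/-!
# Shelf crux `EnstrophyQuarterLaw` (stmt-NavierStokesRegularity-1574): counting tools for a DENSITY sieve

Helper file (`--supports stmt-NavierStokesRegularity-1574 --as helper`; def-free; seat
leafhand-ns-efficiencyfloor-4 g10). Context. The registered line «sparse_sieve» of the crux (skeleton
`3cd087f404df…`) sieves space at every time `t < T` and scale `r` into GOOD balls (small `L³`-mass,
`∫_{B_{2r}} |u(t)|³ < ε₀³`, on which the smoothing envelope acts) and BAD balls, and its open stub
`stub_uniformSparseness` asks for a bound on the number of `4r`-separated bad balls that is UNIFORM in `t` and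
`r`. No a-priori quantity of a first blow-up is known to give such a bound for `L³`-MASS balls (the `L³` norm
blows up, Escauriaza–Seregin–Šverák). The ε-regularity criterion of Choe–Wolf–Yang [cite: ChoeWolfYang2019,
Thm 1; doi:10.1007/s00208-019-01843-2] uses instead the SUPER-LEVEL-SET DENSITY
`r⁻³ · m{y ∈ B(x,r) : |u(y,t)| > ε/r} ≤ ε` as the goodness test, and for THAT test the bad-ball count is free:
by Chebyshev, `m{|u(t)| > ε/r} ≤ ‖u(t)‖³_{L^{3,w}} (r/ε)³`, so at most `‖u(t)‖³_{L^{3,w}} / ε⁴` pairwise disjoint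
bad `r`-balls exist — uniformly in `t` and `r` on the stratum `ess sup_t ‖u(t)‖_{L^{3,w}} ≤ M` (this is the
counting step of CWY's Theorem 2, finitely many singular points at a singular time).

This file proves exactly that counting step, abstractly (any measure space / pseudo-metric space, any
function `f` into a normed group standing for the slice `u(t)`), in the shapes a density-sieve line would
consume: `card · η ≤ μ E` for disjoint measurable pieces each carrying `≥ η` of an ARBITRARY set `E`
(`card_mul_le_measure_of_pairwiseDisjoint`, via `μ.restrict E`, no measurability of `E` needed); the bad-ball
count `card ≤ M³/ε⁴` for disjoint and for `2r`-separated finite families (`card_le_of_densityBad_of_pairwiseDisjoint`,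
`card_le_of_densityBad`); finiteness and the same `ncard` bound for arbitrary disjoint bad families
(`finite_and_ncard_le_of_densityBad`); and the Vitali step: the whole bad set is covered by the doubled balls
of a finite disjoint bad subfamily of size `≤ M³/ε⁴` (`exists_finite_cover_densityBad`).

HONEST FRAMING: elementary measure theory; no statement about Navier–Stokes, no registered stub of line
«sparse_sieve» is closed (its `UniformSparseness` counts `L³`-mass balls, which an `L^{3,w}` bound does NOT
control), the crux `EnstrophyQuarterLaw` stays OPEN and no summit statement is proved. [folklore]
-/

noncomputable section

-- the summit and its single sub-problem share the name (CONVENTIONS §1), as in every Theorems file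
set_option linter.dupNamespace false

namespace Summit.NavierStokesRegularity.NavierStokesRegularity.Theorems.EnstrophyQuarterLaw.DensitySieve

open MeasureTheory Set Metric
open scoped ENNReal

/-- **Disjoint pieces each carrying mass `≥ η` of a set `E` are at most `μ E / η` in number**:
if the measurable sets `B i`, `i ∈ F`, are pairwise disjoint and `η ≤ μ (E ∩ B i)` for each `i ∈ F`, then
`card F · η ≤ μ E`. The set `E` need not be measurable (the sum is taken in `μ.restrict E`). [folklore] -/
theorem card_mul_le_measure_of_pairwiseDisjoint {α : Type*} [MeasurableSpace α] (μ : Measure α)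
    {ι : Type*} (F : Finset ι) (B : ι → Set α) (hB : ∀ i ∈ F, MeasurableSet (B i))
    (hdisj : (F : Set ι).PairwiseDisjoint B) (E : Set α) (η : ℝ≥0∞)
    (hmass : ∀ i ∈ F, η ≤ μ (E ∩ B i)) :
    (F.card : ℝ≥0∞) * η ≤ μ E := by
  calc (F.card : ℝ≥0∞) * η = ∑ _i ∈ F, η := by simp [Finset.sum_const, nsmul_eq_mul]
    _ ≤ ∑ i ∈ F, μ.restrict E (B i) := Finset.sum_le_sum fun i hi => by
        rw [Measure.restrict_apply (hB i hi), Set.inter_comm]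
        exact hmass i hi
    _ = μ.restrict E (⋃ i ∈ F, B i) := (measure_biUnion_finset hdisj hB).symm
    _ ≤ μ.restrict E Set.univ := measure_mono (Set.subset_univ _)
    _ = μ E := Measure.restrict_apply_univ E

/-- `2r`-separated centres have pairwise disjoint open `r`-balls. [folklore] -/
theorem pairwiseDisjoint_ball_of_sep {α : Type*} [PseudoMetricSpace α] (S : Set α) (r : ℝ)
    (hsep : ∀ x ∈ S, ∀ y ∈ S, x ≠ y → 2 * r ≤ dist x y) :
    S.PairwiseDisjoint (fun x => Metric.ball x r) := by
  intro x hx y hy hxy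
  change Disjoint (Metric.ball x r) (Metric.ball y r)
  exact Metric.ball_disjoint_ball (by linarith [hsep x hx y hy hxy])

/-- **Chebyshev count of density-bad balls (disjoint form).** Let `f` be any function into a normed group
(the slice `u(t)`), `0 < ε`, `0 < r`, and suppose the weak-`L³` tail bound at the single height `ε/r`,
`μ {ε/r < ‖f‖} ≤ (M r/ε)³`. If the open balls `B(x,r)`, `x ∈ F`, are pairwise disjoint and each is
DENSITY-BAD, `ε r³ ≤ μ ({ε/r < ‖f‖} ∩ B(x,r))`, then `card F ≤ M³/ε⁴` — uniformly in `r` (the counting step of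
Choe–Wolf–Yang's finiteness theorem). [cite: ChoeWolfYang2019, Thm 2 (proof, §5)] -/
theorem card_le_of_densityBad_of_pairwiseDisjoint {α : Type*} [PseudoMetricSpace α] [MeasurableSpace α]
    [OpensMeasurableSpace α] (μ : Measure α) {β : Type*} [NormedAddCommGroup β] (f : α → β)
    {M ε r : ℝ} (hM : 0 ≤ M) (hε : 0 < ε) (hr : 0 < r)
    (htail : μ {y | ε / r < ‖f y‖} ≤ ENNReal.ofReal ((M * r / ε) ^ 3))
    (F : Finset α) (hdisj : (F : Set α).PairwiseDisjoint (fun x => Metric.ball x r))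
    (hbad : ∀ x ∈ F, ENNReal.ofReal (ε * r ^ 3) ≤ μ ({y | ε / r < ‖f y‖} ∩ Metric.ball x r)) :
    (F.card : ℝ) ≤ M ^ 3 / ε ^ 4 := by
  have h1 : (F.card : ℝ≥0∞) * ENNReal.ofReal (ε * r ^ 3) ≤ μ {y | ε / r < ‖f y‖} :=
    card_mul_le_measure_of_pairwiseDisjoint μ F (fun x => Metric.ball x r)
      (fun _ _ => measurableSet_ball) hdisj _ _ hbad
  have h2 : ENNReal.ofReal ((F.card : ℝ) * (ε * r ^ 3)) ≤ ENNReal.ofReal ((M * r / ε) ^ 3) := by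
    rw [ENNReal.ofReal_mul (by positivity), ENNReal.ofReal_natCast]
    exact h1.trans htail
  have h3 : (F.card : ℝ) * (ε * r ^ 3) ≤ (M * r / ε) ^ 3 :=
    (ENNReal.ofReal_le_ofReal_iff (by positivity)).1 h2
  have h4 : (M * r / ε) ^ 3 = M ^ 3 * r ^ 3 / ε ^ 3 := by rw [div_pow, mul_pow]
  rw [h4, le_div_iff₀ (by positivity)] at h3
  rw [le_div_iff₀ (by positivity)]
  have hr3 : 0 < r ^ 3 := by positivity
  have h5 : (F.card : ℝ) * ε ^ 4 * r ^ 3 ≤ M ^ 3 * r ^ 3 := by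
    calc (F.card : ℝ) * ε ^ 4 * r ^ 3 = (F.card : ℝ) * (ε * r ^ 3) * ε ^ 3 := by ring
      _ ≤ M ^ 3 * r ^ 3 := h3
  exact le_of_mul_le_mul_right h5 hr3

/-- **Chebyshev count of density-bad balls (separated form)**, as a sieve consumes it: a `2r`-separated
finite family of density-bad centres has `card ≤ M³/ε⁴`. [cite: ChoeWolfYang2019, Thm 2 (proof, §5)] -/
theorem card_le_of_densityBad {α : Type*} [PseudoMetricSpace α] [MeasurableSpace α]
    [OpensMeasurableSpace α] (μ : Measure α) {β : Type*} [NormedAddCommGroup β] (f : α → β)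
    {M ε r : ℝ} (hM : 0 ≤ M) (hε : 0 < ε) (hr : 0 < r)
    (htail : μ {y | ε / r < ‖f y‖} ≤ ENNReal.ofReal ((M * r / ε) ^ 3))
    (F : Finset α) (hsep : ∀ x ∈ F, ∀ y ∈ F, x ≠ y → 2 * r ≤ dist x y)
    (hbad : ∀ x ∈ F, ENNReal.ofReal (ε * r ^ 3) ≤ μ ({y | ε / r < ‖f y‖} ∩ Metric.ball x r)) :
    (F.card : ℝ) ≤ M ^ 3 / ε ^ 4 :=
  card_le_of_densityBad_of_pairwiseDisjoint μ f hM hε hr htail F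
    (pairwiseDisjoint_ball_of_sep (F : Set α) r (fun x hx y hy hxy => hsep x hx y hy hxy)) hbad

/-- **Every disjoint family of density-bad balls is finite, with the same bound**: if `S` is ANY set of
centres whose `r`-balls are pairwise disjoint and density-bad, then `S` is finite and `ncard S ≤ M³/ε⁴`.
[cite: ChoeWolfYang2019, Thm 2 (proof, §5)] -/
theorem finite_and_ncard_le_of_densityBad {α : Type*} [PseudoMetricSpace α] [MeasurableSpace α]
    [OpensMeasurableSpace α] (μ : Measure α) {β : Type*} [NormedAddCommGroup β] (f : α → β)
    {M ε r : ℝ} (hM : 0 ≤ M) (hε : 0 < ε) (hr : 0 < r)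
    (htail : μ {y | ε / r < ‖f y‖} ≤ ENNReal.ofReal ((M * r / ε) ^ 3))
    (S : Set α) (hdisj : S.PairwiseDisjoint (fun x => Metric.ball x r))
    (hbad : ∀ x ∈ S, ENNReal.ofReal (ε * r ^ 3) ≤ μ ({y | ε / r < ‖f y‖} ∩ Metric.ball x r)) :
    S.Finite ∧ (S.ncard : ℝ) ≤ M ^ 3 / ε ^ 4 := by
  have key : ∀ F : Finset α, (F : Set α) ⊆ S → (F.card : ℝ) ≤ M ^ 3 / ε ^ 4 := fun F hF =>
    card_le_of_densityBad_of_pairwiseDisjoint μ f hM hε hr htail F (hdisj.subset hF)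
      (fun x hx => hbad x (hF hx))
  have hfin : S.Finite := by
    by_contra hinf
    obtain ⟨F, hFS, hcard⟩ := Set.Infinite.exists_subset_card_eq hinf (⌊M ^ 3 / ε ^ 4⌋₊ + 1)
    have h1 := key F hFS
    rw [hcard] at h1
    have h2 := Nat.lt_floor_add_one (M ^ 3 / ε ^ 4)
    push_cast at h1
    linarith
  refine ⟨hfin, ?_⟩
  obtain ⟨F, hF⟩ := hfin.exists_finset_coe
  rw [← hF, Set.ncard_coe_finset]
  exact key F hF.subset

/-- **Vitali step of the density sieve**: the set `Bad` of ALL density-bad centres at scale `r` is covered by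
the DOUBLED balls `B(x, 2r)` of a finite pairwise-disjoint bad subfamily `S ⊆ Bad` with `ncard S ≤ M³/ε⁴`
(Vitali's covering lemma with equal radii, enlargement factor `2`, then the Chebyshev count). So on the stratum
`‖f‖_{L^{3,w}} ≤ M` the bad region at scale `r` has measure `≤ (M³/ε⁴) · sup_x μ B(x,2r)`, uniformly in `r`.
[cite: ChoeWolfYang2019, Thm 2 (proof, §5)] -/
theorem exists_finite_cover_densityBad {α : Type*} [PseudoMetricSpace α] [MeasurableSpace α]
    [OpensMeasurableSpace α] (μ : Measure α) {β : Type*} [NormedAddCommGroup β] (f : α → β)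
    {M ε r : ℝ} (hM : 0 ≤ M) (hε : 0 < ε) (hr : 0 < r)
    (htail : μ {y | ε / r < ‖f y‖} ≤ ENNReal.ofReal ((M * r / ε) ^ 3)) :
    ∃ S : Set α,
      S ⊆ {x | ENNReal.ofReal (ε * r ^ 3) ≤ μ ({y | ε / r < ‖f y‖} ∩ Metric.ball x r)} ∧
      S.Finite ∧ (S.ncard : ℝ) ≤ M ^ 3 / ε ^ 4 ∧ S.PairwiseDisjoint (fun x => Metric.ball x r) ∧
      {x | ENNReal.ofReal (ε * r ^ 3) ≤ μ ({y | ε / r < ‖f y‖} ∩ Metric.ball x r)} ⊆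
        ⋃ x ∈ S, Metric.ball x (2 * r) := by
  set Bad : Set α := {x | ENNReal.ofReal (ε * r ^ 3) ≤ μ ({y | ε / r < ‖f y‖} ∩ Metric.ball x r)}
    with hBad_def
  obtain ⟨S, hSBad, hSdisj, hScov⟩ :=
    Vitali.exists_disjoint_subfamily_covering_enlargement (fun x : α => Metric.ball x r) Bad
      (fun _ => r) 2 one_lt_two (fun _ _ => hr.le) r (fun _ _ => le_rfl)
      (fun x _ => ⟨x, Metric.mem_ball_self hr⟩)
  have hfin := finite_and_ncard_le_of_densityBad μ f hM hε hr htail S hSdisj (fun x hx => hSBad hx)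
  refine ⟨S, hSBad, hfin.1, hfin.2, hSdisj, fun x hx => ?_⟩
  obtain ⟨b, hbS, ⟨z, hzx, hzb⟩, -⟩ := hScov x hx
  refine Set.mem_biUnion hbS ?_
  rw [Metric.mem_ball] at hzx hzb ⊢
  calc dist x b ≤ dist x z + dist z b := dist_triangle x z b
    _ = dist z x + dist z b := by rw [dist_comm x z]
    _ < r + r := add_lt_add hzx hzb
    _ = 2 * r := by ring

end Summit.NavierStokesRegularity.NavierStokesRegularity.Theorems.EnstrophyQuarterLaw.DensitySieve

end
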